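import Literature.NumberTheory.EllipticCurves.IwasawaAlgebraProofs
import HarnessLib

/-!
# `μ` and `λ` of a power series over `ℤ_p`: reduction mod `p`, the `p`-free part, `μ`, `λ` (definitions; re-homed)

**The named fact `WeierstrassCurve.isDescendedFrobeniusMatrix_exists` (`DescendedFrobeniusMatrix.lean`: for `W/ℚ` with a good model over `𝓞_L`,
`L = ℚ₃(ζ₉)`, of supersingular special fibre, a descended crystalline Frobenius matrix `M ∈ M₂(ℚ₃)` exists and `tr M = a`) HOLDS — EXACT name
`WeierstrassCurve.isDescendedFrobeniusMatrix_exists_holds`** ([Katz1981CrystallineDieudonne] N. Katz, *Crystalline cohomology, Dieudonné modules, and Jacobi sums*,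
Thm. 5.1.4, 5.3.3, (5.5.7), 5.7.2, (6.1.1); [BerthelotOgus1983] (2.4), (3.14); Honda's theory of formal groups and the Katz–Messing point-count relation
`φ² − aφ + 3 = 0`).  Contents: (1, definitions file) `μ`, `λ`, the reduction mod `p` and the `p`-free part of a power series over `ℤ_p`;
(2–4) the ring `𝓞_L = ℤ₃[ζ₉]` (`ONine`: integers, residue map, local structure, integral coordinates), transfer of the descended Frobenius along good
models (semantics, basis, good-model transport and its calculus), the formal endomorphism algebra and its `p`-adic digits, Katz's Frobenius modulo `ϖ` and
the Frobenius relation, bounded formal logarithms `⇔` divisibility, the `p`-adic rank-two assembly, coefficient computations in the formal group of a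
Weierstrass curve (`formalW`, `formalΩ`, `formalLog`), the formal `η`-coboundary and residue, Honda estimates and congruences, unbounded `log`, `η`-integrality,
independence of the classes `[ω], [η]`, the second-kind logarithm, the Katz rank of a `p`-adic rank, the supersingular Katz rank, the `p`-adic digit limit;
(5) Galois descent from `L` to `ℚ₃`, the named fact from the Katz rank, the rank-two reduction, and the discharge.
RE-HOMED into `Literature/` by the Hodge foundations lane (`lit-hodgefound`, seat p20, generation 40): verbatim DECLARATION-LEVEL ports (the 331 declarations needed, in
dependency order; each Part is a slice of one Summits module) of 45 theorem modules `Summits/BirchSwinnertonDyer/BirchSwinnertonDyer/Theorems/CyclotomicUntwist*.lean`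
(+ three formal-group coefficient files and `Rank1Residual/{X1/MuLambdaAlgebra,O5/…}`); the namespace `Summit.BirchSwinnertonDyer.BirchSwinnertonDyer.Theorems` is re-rooted at
`Literature.NumberTheory.EllipticCurves.DescendedFrobenius` (module sub-namespaces kept; the coefficient lemmas gathered in `….FormalGroupCoefficients`, the two `3`-adic norm lemmas in
`….PadicNormAux`, `μ`/`λ` in `Literature.NumberTheory.EllipticCurves.MuLambda`).  No new named fact (D-0026); imports Mathlib/Literature only; every declaration carries the citation of the
printed statement it formalises or serves.  The Summits originals stay in place (transitional duplication).  WHAT THIS IS NOT: nothing here bears on BSD; it is the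
crystalline / formal-group computation of the Frobenius matrix at `3` for curves acquiring good reduction over `ℚ₃(ζ₉)`.  (This is file 1 of 5, the definitions file; the discharge is in file 5.)
-/

noncomputable section

/-!
## Part 1 — port of `Summits/BirchSwinnertonDyer/Rank1Residual/X1/MuLambdaAlgebra.lean` (6 declarations kept)

# `μ` and `λ` of a power series `g` over `ℤ_p`: the reduction `red g` modulo `p`, `μ(g)` = the exact power of `p` dividing `g`, the `p`-free part `pfree g`, and `λ(g)` = the order of `red (pfree g)` (the Weierstrass degree; Washington §7.1, Greenberg–Vatsal (1)–(2))

Declarations of this Part (verbatim port; each keeps its own docstring and citation): `red`, `bddAbove_setOf_C_pow_dvd`, `mu`, `C_pow_mu_dvd`, `pfree`, `lam`.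

Reference keys (see `references.bib` and the declarations' citations): [GreenbergVatsal2000].
-/

section Part1

open scoped _root_.Classical

open Literature.NumberTheory.EllipticCurves

namespace Literature.NumberTheory.EllipticCurves.MuLambda

section Algebra

variable {p : ℕ} [Fact p.Prime]

/-- Reduction of `g ∈ Λ = ℤ_p⟦T⟧` modulo `p`: the image in `𝔽_p⟦T⟧` (coefficientwise residue map).
Washington §13.1 (`Λ/pΛ ≅ 𝔽_p⟦T⟧`). [cite: GreenbergVatsal2000, p. 2, (2)] -/
abbrev red (g : IwasawaAlgebra p) : PowerSeries (IsLocalRing.ResidueField ℤ_[p]) :=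
  PowerSeries.map (IsLocalRing.residue ℤ_[p]) g

/-- The set of exponents `n` with `p ^ n ∣ g` is bounded above when `g ≠ 0` (by the valuation of
any nonzero coefficient). [cite: GreenbergVatsal2000, p. 2, (2)] -/
theorem bddAbove_setOf_C_pow_dvd {g : IwasawaAlgebra p} (hg : g ≠ 0) :
    BddAbove {n : ℕ | PowerSeries.C ((p : ℤ_[p]) ^ n) ∣ g} := by
  obtain ⟨k, hk⟩ : ∃ k, PowerSeries.coeff k g ≠ 0 := by
    by_contra h
    push Not at h
    exact hg (PowerSeries.ext (by simpa using h))
  refine ⟨(PowerSeries.coeff k g).valuation, fun n hn => ?_⟩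
  have hdvd : ((p : ℤ_[p]) ^ n) ∣ PowerSeries.coeff k g :=
    (Literature.NumberTheory.EllipticCurves.PowerSeries.C_dvd_iff_forall_dvd_coeff _ g).mp hn k
  exact (PadicInt.mem_span_pow_iff_le_valuation _ hk n).mp (Ideal.mem_span_singleton.mpr hdvd)

/-- **The `μ`-invariant of `g ∈ Λ`**: the largest `n` with `p ^ n ∣ g` — Greenberg–Vatsal (2):
"`p^{μ}` is the exact power of `p` dividing `f(T)` in `Λ`" (junk value for `g = 0`).
[cite: GreenbergVatsal2000, p. 2, (2)] -/
def mu (g : IwasawaAlgebra p) : ℕ := sSup {n : ℕ | PowerSeries.C ((p : ℤ_[p]) ^ n) ∣ g}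

/-- `p ^ μ(g) ∣ g`. [cite: GreenbergVatsal2000, p. 2, (2)] -/
theorem C_pow_mu_dvd {g : IwasawaAlgebra p} (hg : g ≠ 0) :
    PowerSeries.C ((p : ℤ_[p]) ^ mu g) ∣ g := by
  have hne : ({n : ℕ | PowerSeries.C ((p : ℤ_[p]) ^ n) ∣ g} : Set ℕ).Nonempty := ⟨0, by simp⟩
  exact Nat.sSup_mem hne (bddAbove_setOf_C_pow_dvd hg)

/-- **The `p`-free part**: `g = p^{μ(g)} · pfree g` with `pfree g ≢ 0 (mod p)` (for `g ≠ 0`; junk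
`0` for `g = 0`). [cite: GreenbergVatsal2000, p. 2, (2)] -/
def pfree (g : IwasawaAlgebra p) : IwasawaAlgebra p :=
  if hg : g = 0 then 0 else Classical.choose (C_pow_mu_dvd hg)

/-- **The `λ`-invariant of `g ∈ Λ`**: the order of vanishing at `T = 0` of `(g / p^{μ(g)}) mod p`
in `𝔽_p⟦T⟧` — by Weierstrass preparation the degree of the distinguished polynomial of `g`
(Washington §7.1; Greenberg–Vatsal (1): `λ = deg f(T)`). [cite: GreenbergVatsal2000, p. 2–3, (1)–(2)] -/
def lam (g : IwasawaAlgebra p) : ℕ := (red (pfree g)).order.toNat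

end Algebra

end Literature.NumberTheory.EllipticCurves.MuLambda

end Part1

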